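import Summits.ResolutionOfSingularities.ResolutionOfSingularities.Theorems.PurityCutClasses2
import HarnessLib

/-!
# PurityCutGrand — decomp-res node «PurityCut» (lens-2 g16 rev 1)

Content VERBATIM from the decomp-res lens-2 g16 node `HOME/decomp-res-lens-2/g16/PurityCut.lean` rev 1 (pin c1c78f8a
= `parts/PurityCut-rev1-c1c78f8a.lean`, 2 025 l;
HOME = run/shared/lean/pub/decomp-res; CRITIC-LEDGER row 140 CLEARED; landing orders INBOX :288 (row-140 line: split
/ order / asides) and :296 (land from rev 1:
docstring-only changes + eight ring-identity kernels).  The lens's §R (l. 121–1020: 89 declarations RESTATED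
VERBATIM-IN-BODY from lens-2 g14 `PinchCut` rev 1 and
g15 `JetCut` rev 5) is DELETED — those are the tree's `PinchCutClasses` / `PinchCutKernels` / `JetCut*` modules
(namespaces `…Theorems.PinchCut`, `…Theorems.JetCut`
with its sub-namespace `Vast`, opened; same short names, byte-identical bodies — never two copies).  Namespace
`…Theorems.PurityCut` (the lens's `Theses.PurityCut`
is gate-reserved), sub-namespaces `Leaf` / `Grand` as in the lens; file split only (tree files ≤ 400 lines):
sections, variables and every declaration exactly as in
the lens.  Node files, in import order: `PurityCutLeaf` (§G) · `PurityCutClasses` (§P, continued `…2` / `…3` as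
needed) · `PurityCutGrand` (§H cone-free: the aside
home) · the wiring `MaxContactCutPurityCut` (§G/§H BY NAME on the host route, in the Theses cone).  All `--supports
stmt-ResolutionOfSingularities-29273`
(`MaxContactCut.RungOne`); nothing closes 29273 — decided halves carry their engines as hypotheses; exactly ONE
located-residual aside is booked on the route for
the lens-2 column (`Grand.GrandSpecialRung`, home `PurityCutGrand`), SUPERSEDING the JetCut residual
`Vast.VastSpecialRung` (critic :288: «if Vast is not yet filed,
file Grand only; never both») and re-locating the tree aside 33866 `LeafSpecialRung` EXACTLY modulo the grand decided half.

§H (NEW, g16), cone-free part — `namespace Grand`: the leaves of the lineage as instances of §G (`vastLeaf`,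
`grandLeaf`, the order lemmas `…_le_grandLeaf`), the rungs of the grand leaf **`GrandGenericRung`** (DECIDED half,
engines as hypotheses: `grandGenericRung_of_engines`) / **`GrandSpecialRung`** (THE LOCATED RESIDUAL of the node —
the ONE aside booked on the route for the lens-2 column, SUPERSEDING g15's `Vast.VastSpecialRung` and the tree's
33866 `LeafSpecialRung`; its docstring must NOT list S5/P3/P5 as residual content, per rev 1), `vastSpecialRung_iff
: Vast.VastSpecialRung ↔ Leaf.SpecialRung vastLeaf`, `grandSpecialRung_of_vastSpecialRung` — statement-level + pure
logic; this module is the cone-free aside home.  The cut BY NAME on the route (`Grand.rungOne_iff`, `Grand.closes`,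
`closes_of_engines`, `vastSpecialRung_iff_grandSpecialRung`, `leafSpecialRung_iff_grandSpecialRung`, …) is in
`MaxContactCutPurityCut`.

(Sources: Hironaka1964 Ch. III; CossartJannsenSaito2020 Ch. 2, Ch. 8–9; CossartPiltant2008 Prop. 4.2;
CossartPiltant2019 Rem. 3.2; BierstoneGrigorievMilmanWlodarczyk2011 §3.1; Moh1987; Hauser2010Kangaroo; Giraud1975;
Narasimhan1983; HunekeSwanson2006 Cor. 5.5.5.)
-/

open CategoryTheory AlgebraicGeometry TopologicalSpace IsLocalRing
open Literature.AlgebraicGeometry.Resolution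
open Summit.ResolutionOfSingularities.ResolutionOfSingularities.Theorems
open Summit.ResolutionOfSingularities.ResolutionOfSingularities.Theorems.WeakOrderReduction
open Summit.ResolutionOfSingularities.ResolutionOfSingularities.Theorems.DeltaFaceCutClasses
open Summit.ResolutionOfSingularities.ResolutionOfSingularities.Theorems.RelativeDeltaCut
open Summit.ResolutionOfSingularities.ResolutionOfSingularities.Theorems.CurveLeafExit
open Summit.ResolutionOfSingularities.ResolutionOfSingularities.Theorems.PinchCut
open Summit.ResolutionOfSingularities.ResolutionOfSingularities.Theorems.JetCut

namespace Summit.ResolutionOfSingularities.ResolutionOfSingularities.Theorems.PurityCut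

/-! ## §H  NEW (g16): the GRAND cut — the leaves of the lineage as instances of §G, the rungs of the grand leaf,
`closes` BY NAME,
the engines at work, and the EXACT RE-LOCATIONS: of g15's `Vast.VastSpecialRung` (restated verbatim-in-body,
§R15.V), of the TREE
aside `MaxContactCut.LeafSpecialRung` (33866, BY NAME) and of g14's `PinchSpecialRung` (restated) — all modulo the grand decided
half, all 0 sorry. -/

/-- The PINCH leaf of g14: pinch-curve ∨ cone-curve.  DEFINITION (leaf instance). [folklore] -/
def pinchLeaf : ∀ ⦃Y : Scheme.{0}⦄, Y.IdealSheafData → ℕ → Y → Prop :=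
  fun _ I n y => IsPinchCurvePt I n y ∨ IsConeCurvePt I n y

/-- The VAST leaf of g15 rev 5: pinch-curve ∨ cone-curve ∨ vast-curve.  DEFINITION (leaf instance). [folklore] -/
def vastLeaf : ∀ ⦃Y : Scheme.{0}⦄, Y.IdealSheafData → ℕ → Y → Prop :=
  fun _ I n y => IsPinchCurvePt I n y ∨ IsConeCurvePt I n y ∨ IsVastCurvePt I n y

/-- The GRAND leaf of g16: pinch-curve ∨ cone-curve ∨ grand-curve ((V) ∪ (D⁺)).  DEFINITION (leaf instance). [folklore] -/
def grandLeaf : ∀ ⦃Y : Scheme.{0}⦄, Y.IdealSheafData → ℕ → Y → Prop :=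
  fun _ I n y => IsPinchCurvePt I n y ∨ IsConeCurvePt I n y ∨ IsGrandCurvePt I n y

/-- `pinchLeaf_le_vastLeaf`: Auxiliary step of this node's calculus, VERBATIM from the lens file (see the module
docstring); the statement is its type. [folklore] -/
theorem pinchLeaf_le_vastLeaf ⦃Y : Scheme.{0}⦄ (I : Y.IdealSheafData) (n : ℕ) (y : Y) :
    pinchLeaf I n y → vastLeaf I n y := by
  rintro (h | h)
  · exact Or.inl h
  · exact Or.inr (Or.inl h)

/-- `vastLeaf_le_grandLeaf`: Auxiliary step of this node's calculus, VERBATIM from the lens file (see the module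
docstring); the statement is its type. [folklore] -/
theorem vastLeaf_le_grandLeaf ⦃Y : Scheme.{0}⦄ (I : Y.IdealSheafData) (n : ℕ) (y : Y) :
    vastLeaf I n y → grandLeaf I n y := by
  rintro (h | h | h)
  · exact Or.inl h
  · exact Or.inr (Or.inl h)
  · exact Or.inr (Or.inr (Or.inl h))

/-- `pinchLeaf_le_grandLeaf`: Auxiliary step of this node's calculus, VERBATIM from the lens file (see the module
docstring); the statement is its type. [folklore] -/
theorem pinchLeaf_le_grandLeaf ⦃Y : Scheme.{0}⦄ (I : Y.IdealSheafData) (n : ℕ) (y : Y) :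
    pinchLeaf I n y → grandLeaf I n y :=
  fun h => vastLeaf_le_grandLeaf I n y (pinchLeaf_le_vastLeaf I n y h)

/-- Pointwise: g14's pinch-special class IS the `pinchLeaf`-special class of §G.  KERNEL (PROVED). [folklore] -/
theorem isSpecPt_pinchLeaf_iff {k : Type} [Field k] {Y : Scheme.{0}} (g : Y ⟶ Spec (.of k)) (hY : Scheme.IsRegular Y)
    (I : Y.IdealSheafData) (n : ℕ) (y : Y) : Leaf.IsSpecPt pinchLeaf g hY I n y ↔ IsPinchSpecialPt g hY I n y := by
  constructor
  · rintro ⟨hL, hno⟩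
    exact ⟨hL, fun h => hno (Or.inl h), fun h => hno (Or.inr h)⟩
  · rintro ⟨hL, hP, hC⟩
    exact ⟨hL, fun h => h.elim hP hC⟩

/-- Pointwise: g15's vast-special class IS the `vastLeaf`-special class.  KERNEL (PROVED). [folklore] -/
theorem isSpecPt_vastLeaf_iff {k : Type} [Field k] {Y : Scheme.{0}} (g : Y ⟶ Spec (.of k)) (hY : Scheme.IsRegular Y)
    (I : Y.IdealSheafData) (n : ℕ) (y : Y) : Leaf.IsSpecPt vastLeaf g hY I n y ↔ IsVastSpecialPt g hY I n y := by
  constructor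
  · rintro ⟨hL, hno⟩
    exact ⟨⟨hL, fun h => hno (Or.inl h), fun h => hno (Or.inr (Or.inl h))⟩, fun h => hno (Or.inr (Or.inr h))⟩
  · rintro ⟨⟨hL, hP, hC⟩, hV⟩
    refine ⟨hL, ?_⟩
    rintro (h | h | h)
    · exact hP h
    · exact hC h
    · exact hV h

/-- Pointwise: g16's grand-special class IS the `grandLeaf`-special class.  KERNEL (PROVED). [folklore] -/
theorem isSpecPt_grandLeaf_iff {k : Type} [Field k] {Y : Scheme.{0}} (g : Y ⟶ Spec (.of k)) (hY : Scheme.IsRegular Y)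
    (I : Y.IdealSheafData) (n : ℕ) (y : Y) : Leaf.IsSpecPt grandLeaf g hY I n y ↔ IsGrandSpecialPt g hY I n y := by
  constructor
  · rintro ⟨hL, hno⟩
    exact ⟨⟨hL, fun h => hno (Or.inl h), fun h => hno (Or.inr (Or.inl h))⟩, fun h => hno (Or.inr (Or.inr h))⟩
  · rintro ⟨⟨hL, hP, hC⟩, hG⟩
    refine ⟨hL, ?_⟩
    rintro (h | h | h)
    · exact hP h
    · exact hC h
    · exact hG h

/-- Pointwise: g15's nine-class decided union IS `Leaf.IsGenPt vastLeaf` (reassociation).  KERNEL (PROVED). [folklore] -/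
theorem isGenPt_vastLeaf_iff {k : Type} [Field k] {Y : Scheme.{0}} (g : Y ⟶ Spec (.of k)) (hY : Scheme.IsRegular Y)
    (I : Y.IdealSheafData) (n : ℕ) (y : Y) :
    Leaf.IsGenPt vastLeaf g hY I n y ↔
      (ClassGE g hY I n 2 y ∨ VeryNearCutClasses.IsNearGenericPt I n y ∨ IsDeltaGenericPt I n y ∨
        IsCurveGenericPt I n y ∨ IsRelCurveGenericPt I n y ∨ IsFlatCurvePt I n y ∨
        IsPinchCurvePt I n y ∨ IsConeCurvePt I n y ∨ IsVastCurvePt I n y) := by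
  constructor
  · rintro ((h | h | h | h | h | h) | (h | h | h))
    · exact Or.inl h
    · exact Or.inr (Or.inl h)
    · exact Or.inr (Or.inr (Or.inl h))
    · exact Or.inr (Or.inr (Or.inr (Or.inl h)))
    · exact Or.inr (Or.inr (Or.inr (Or.inr (Or.inl h))))
    · exact Or.inr (Or.inr (Or.inr (Or.inr (Or.inr (Or.inl h)))))
    · exact Or.inr (Or.inr (Or.inr (Or.inr (Or.inr (Or.inr (Or.inl h))))))
    · exact Or.inr (Or.inr (Or.inr (Or.inr (Or.inr (Or.inr (Or.inr (Or.inl h)))))))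
    · exact Or.inr (Or.inr (Or.inr (Or.inr (Or.inr (Or.inr (Or.inr (Or.inr h)))))))
  · rintro (h | h | h | h | h | h | h | h | h)
    · exact Or.inl (Or.inl h)
    · exact Or.inl (Or.inr (Or.inl h))
    · exact Or.inl (Or.inr (Or.inr (Or.inl h)))
    · exact Or.inl (Or.inr (Or.inr (Or.inr (Or.inl h))))
    · exact Or.inl (Or.inr (Or.inr (Or.inr (Or.inr (Or.inl h)))))
    · exact Or.inl (Or.inr (Or.inr (Or.inr (Or.inr (Or.inr h)))))
    · exact Or.inr (Or.inl h)
    · exact Or.inr (Or.inr (Or.inl h))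
    · exact Or.inr (Or.inr (Or.inr h))

/-- Pointwise: g14's eight-class decided union IS `Leaf.IsGenPt pinchLeaf`.  KERNEL (PROVED). [folklore] -/
theorem isGenPt_pinchLeaf_iff {k : Type} [Field k] {Y : Scheme.{0}} (g : Y ⟶ Spec (.of k)) (hY : Scheme.IsRegular Y)
    (I : Y.IdealSheafData) (n : ℕ) (y : Y) :
    Leaf.IsGenPt pinchLeaf g hY I n y ↔
      (ClassGE g hY I n 2 y ∨ VeryNearCutClasses.IsNearGenericPt I n y ∨ IsDeltaGenericPt I n y ∨
        IsCurveGenericPt I n y ∨ IsRelCurveGenericPt I n y ∨ IsFlatCurvePt I n y ∨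
        IsPinchCurvePt I n y ∨ IsConeCurvePt I n y) := by
  constructor
  · rintro ((h | h | h | h | h | h) | (h | h))
    · exact Or.inl h
    · exact Or.inr (Or.inl h)
    · exact Or.inr (Or.inr (Or.inl h))
    · exact Or.inr (Or.inr (Or.inr (Or.inl h)))
    · exact Or.inr (Or.inr (Or.inr (Or.inr (Or.inl h))))
    · exact Or.inr (Or.inr (Or.inr (Or.inr (Or.inr (Or.inl h)))))
    · exact Or.inr (Or.inr (Or.inr (Or.inr (Or.inr (Or.inr (Or.inl h))))))
    · exact Or.inr (Or.inr (Or.inr (Or.inr (Or.inr (Or.inr (Or.inr h))))))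
  · rintro (h | h | h | h | h | h | h | h)
    · exact Or.inl (Or.inl h)
    · exact Or.inl (Or.inr (Or.inl h))
    · exact Or.inl (Or.inr (Or.inr (Or.inl h)))
    · exact Or.inl (Or.inr (Or.inr (Or.inr (Or.inl h))))
    · exact Or.inl (Or.inr (Or.inr (Or.inr (Or.inr (Or.inl h)))))
    · exact Or.inl (Or.inr (Or.inr (Or.inr (Or.inr (Or.inr h)))))
    · exact Or.inr (Or.inl h)
    · exact Or.inr (Or.inr h)

/-! ### §H1  The lineage's statements ARE the §G schema (hypothesis-free `Iff`s, so every re-location below is by letter) -/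

/-- g15's `Vast.SeqVGen n` IS `Leaf.SeqGen vastLeaf n`.  KERNEL (PROVED). [folklore] -/
theorem seqVGen_iff (n : ℕ) : Vast.SeqVGen n ↔ Leaf.SeqGen vastLeaf n := by
  constructor
  · intro h p hp k _ _ Y g h1 h2 h3 hY h4 I hord hcls
    exact h p hp k Y g h1 h2 h3 hY h4 I hord (fun y hy => (isGenPt_vastLeaf_iff g hY I n y).mp (hcls y hy))
  · intro h p hp k _ _ Y g h1 h2 h3 hY h4 I hord hcls
    exact h p hp k Y g h1 h2 h3 hY h4 I hord (fun y hy => (isGenPt_vastLeaf_iff g hY I n y).mpr (hcls y hy))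

/-- g15's `Vast.SeqVSpec n` IS `Leaf.SeqSpec vastLeaf n`.  KERNEL (PROVED). [folklore] -/
theorem seqVSpec_iff (n : ℕ) : Vast.SeqVSpec n ↔ Leaf.SeqSpec vastLeaf n := by
  constructor
  · intro h p hp k _ _ Y g h1 h2 h3 hY h4 I hord hex
    obtain ⟨y, hy, hs⟩ := hex
    exact h p hp k Y g h1 h2 h3 hY h4 I hord ⟨y, hy, (isSpecPt_vastLeaf_iff g hY I n y).mp hs⟩
  · intro h p hp k _ _ Y g h1 h2 h3 hY h4 I hord hex
    obtain ⟨y, hy, hs⟩ := hex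
    exact h p hp k Y g h1 h2 h3 hY h4 I hord ⟨y, hy, (isSpecPt_vastLeaf_iff g hY I n y).mpr hs⟩

/-- g14's `SeqPGen n` IS `Leaf.SeqGen pinchLeaf n`.  KERNEL (PROVED). [folklore] -/
theorem seqPGen_iff (n : ℕ) : SeqPGen n ↔ Leaf.SeqGen pinchLeaf n := by
  constructor
  · intro h p hp k _ _ Y g h1 h2 h3 hY h4 I hord hcls
    exact h p hp k Y g h1 h2 h3 hY h4 I hord (fun y hy => (isGenPt_pinchLeaf_iff g hY I n y).mp (hcls y hy))
  · intro h p hp k _ _ Y g h1 h2 h3 hY h4 I hord hcls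
    exact h p hp k Y g h1 h2 h3 hY h4 I hord (fun y hy => (isGenPt_pinchLeaf_iff g hY I n y).mpr (hcls y hy))

/-- g14's `SeqPSpec n` IS `Leaf.SeqSpec pinchLeaf n`.  KERNEL (PROVED). [folklore] -/
theorem seqPSpec_iff (n : ℕ) : SeqPSpec n ↔ Leaf.SeqSpec pinchLeaf n := by
  constructor
  · intro h p hp k _ _ Y g h1 h2 h3 hY h4 I hord hex
    obtain ⟨y, hy, hs⟩ := hex
    exact h p hp k Y g h1 h2 h3 hY h4 I hord ⟨y, hy, (isSpecPt_pinchLeaf_iff g hY I n y).mp hs⟩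
  · intro h p hp k _ _ Y g h1 h2 h3 hY h4 I hord hex
    obtain ⟨y, hy, hs⟩ := hex
    exact h p hp k Y g h1 h2 h3 hY h4 I hord ⟨y, hy, (isSpecPt_pinchLeaf_iff g hY I n y).mpr hs⟩

/-- `vastGenericRung_iff`: Auxiliary step of this node's calculus, VERBATIM from the lens file (see the module
docstring); the statement is its type. [folklore] -/
theorem vastGenericRung_iff : Vast.VastGenericRung ↔ Leaf.GenericRung vastLeaf :=
  ⟨fun h hE2 n hn => (seqVGen_iff n).mp (h hE2 n hn), fun h hE2 n hn => (seqVGen_iff n).mpr (h hE2 n hn)⟩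

/-- `vastSpecialRung_iff`: Auxiliary step of this node's calculus, VERBATIM from the lens file (see the module
docstring); the statement is its type. [folklore] -/
theorem vastSpecialRung_iff : Vast.VastSpecialRung ↔ Leaf.SpecialRung vastLeaf :=
  ⟨fun h hE2 n hn => (seqVSpec_iff n).mp (h hE2 n hn), fun h hE2 n hn => (seqVSpec_iff n).mpr (h hE2 n hn)⟩

/-- `pinchGenericRung_iff`: Auxiliary step of this node's calculus, VERBATIM from the lens file (see the module
docstring); the statement is its type. [folklore] -/
theorem pinchGenericRung_iff : PinchGenericRung ↔ Leaf.GenericRung pinchLeaf :=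
  ⟨fun h hE2 n hn => (seqPGen_iff n).mp (h hE2 n hn), fun h hE2 n hn => (seqPGen_iff n).mpr (h hE2 n hn)⟩

/-- `pinchSpecialRung_iff`: Auxiliary step of this node's calculus, VERBATIM from the lens file (see the module
docstring); the statement is its type. [folklore] -/
theorem pinchSpecialRung_iff : PinchSpecialRung ↔ Leaf.SpecialRung pinchLeaf :=
  ⟨fun h hE2 n hn => (seqPSpec_iff n).mp (h hE2 n hn), fun h hE2 n hn => (seqPSpec_iff n).mpr (h hE2 n hn)⟩

namespace Grand

/-! ### §H2  The graded statements of the GRAND cut (instances of §G with the grand leaf) -/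

/-- **`SeqGGen n`** — weak order reduction in dimension four at marking `n` for data ALL of whose top points are of class ≥ 2,
near-generic, δ-generic, curve-generic, rel-curve-generic, flat-curve, pinch-curve, cone-curve or GRAND-CURVE points (jet-tame-,
ladder-, mixed-ladder-, degenerate-ladder- or PURE-LADDER-curve).  [DECIDED-MOD-PORT: `gGenRungAt_of_engines`.]
STATEMENT SCHEMA
(= `Leaf.SeqGen grandLeaf n`). (Sources: BierstoneGrigorievMilmanWlodarczyk2011 §3.1; CossartPiltant2008 Prop. 4.2;
Hironaka1967.) -/
def SeqGGen (n : ℕ) : Prop := Leaf.SeqGen grandLeaf n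

/-- **`SeqGSpec n`** — THE LOCATED CLASS: weak order reduction at marking `n` for data having a GRAND-SPECIAL core top point.
[UNDECIDED · IDEA-NEEDED.]  STATEMENT SCHEMA (= `Leaf.SeqSpec grandLeaf n`). (Sources: CossartPiltant2019 Rem. 3.2; Moh1987.) -/
def SeqGSpec (n : ℕ) : Prop := Leaf.SeqSpec grandLeaf n

/-- `GGenRungAt n` — the decided rung at one marking. -/
def GGenRungAt (n : ℕ) : Prop := SeqDimFour 2 n → SeqGGen n

/-- **`GrandGenericRung`** — the DECIDED half of `RungOne` (29273): `E 2 →` weak order reduction for every marking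
and all data whose
core top points are in the nine decided classes or PURE-LADDER-curve points.  [WEAKER · DECIDED-MOD-PORT(M+):
`grandGenericRung_of_engines`.]  STATEMENT (decided piece). (Sources: CossartPiltant2008 Prop. 4.2; Hironaka1967;
CossartJannsenSaito2020.) -/
def GrandGenericRung : Prop := E 2 → ∀ n : ℕ, 1 ≤ n → SeqGGen n

/-- **`GrandSpecialRung`** — THE LOCATED RESIDUAL of this node: `E 2 →` weak order reduction for every marking and
all data with a
grand-special core top point.  [WEAKER BY LETTER than `Vast.VastSpecialRung` · UNDECIDED · IDEA-NEEDED · cofinal ⇒ score 0.]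
STATEMENT (located residual). (Sources: CossartPiltant2019 Rem. 3.2; Moh1987; Giraud1975; Narasimhan1983.) -/
def GrandSpecialRung : Prop := E 2 → ∀ n : ℕ, 1 ≤ n → SeqGSpec n

/-- `grandGenericRung_iff`: Auxiliary step of this node's calculus, VERBATIM from the lens file (see the module
docstring); the statement is its type. [folklore] -/
theorem grandGenericRung_iff : GrandGenericRung ↔ Leaf.GenericRung grandLeaf := Iff.rfl

/-- `grandSpecialRung_iff`: Auxiliary step of this node's calculus, VERBATIM from the lens file (see the module
docstring); the statement is its type. [folklore] -/
theorem grandSpecialRung_iff : GrandSpecialRung ↔ Leaf.SpecialRung grandLeaf := Iff.rfl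

section Kernels

variable {n : ℕ}

/-! ### §H3  Kernels of the GRAND cut (instantiated from §G; 0 sorry) -/

/-- **EXACT at each marking**: `SeqDimFour 1 n ⟺ SeqGGen n ∧ SeqGSpec n`. [folklore] -/
theorem seqDimFour_one_iff : SeqDimFour 1 n ↔ SeqGGen n ∧ SeqGSpec n :=
  Leaf.seqDimFour_one_iff (L := grandLeaf)

/-- Under the engines (M) (C) (G) every point of the grand leaf is a curve-exit point. [folklore] -/
theorem isCurveExitPt_of_grandLeaf (hM : MonomialPinchExit) (hC : FlatConeExit) (hGE : GrandExit) (hn : 2 ≤ n)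
    ⦃Y : Scheme.{0}⦄ (hY : Scheme.IsRegular Y) ⦃I : Y.IdealSheafData⦄ ⦃y : Y⦄ (h : grandLeaf I n y) :
    IsCurveExitPt I n y := by
  rcases h with h | h | h
  · exact isCurveExitPt_of_isPinchCurvePt hM hY hn h
  · exact isCurveExitPt_of_isConeCurvePt hC hY hn h
  · exact isCurveExitPt_of_isGrandCurvePt hGE hY hn h

/-- **THE ENGINES AT WORK**: the five tree engines, g14's (M) and (C), the grand engine (G) = (V) ∧ (D⁺) and g12's port give
`GGenRungAt n` for `n ≥ 2`. [folklore] -/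
theorem gGenRungAt_of_engines (hV : VeryNearCutClasses.VeryNearExit) (hD : DeltaPackageExit)
    (hU : UniformCurvePackageExit) (hR : RelCurvePackageExit) (hN : NormalConeJumpExit)
    (hM : MonomialPinchExit) (hC : FlatConeExit) (hGE : GrandExit) (hP : CurvePackagePort n) (hn : 2 ≤ n) :
    GGenRungAt n :=
  Leaf.genRungAt_of_port (L := grandLeaf) hV hD hU hR hN (isCurveExitPt_of_grandLeaf hM hC hGE hn) hP hn

/-- **`GrandGenericRung` is DECIDED modulo the typed pieces**: engines (as hypotheses), g12's port at every marking `≥ 2`, the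
order-one contact port. [folklore] -/
theorem grandGenericRung_of_engines (hV : VeryNearCutClasses.VeryNearExit) (hD : DeltaPackageExit)
    (hU : UniformCurvePackageExit) (hR : RelCurvePackageExit) (hN : NormalConeJumpExit)
    (hM : MonomialPinchExit) (hC : FlatConeExit) (hGE : GrandExit)
    (hP : ∀ n : ℕ, 2 ≤ n → CurvePackagePort n) (h1 : FaceFormCutClasses.OrderOneContact) : GrandGenericRung :=
  Leaf.genericRung_of_port (L := grandLeaf) hV hD hU hR hN
    (fun _ hn => isCurveExitPt_of_grandLeaf hM hC hGE hn) hP h1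

/-! ### §H4  EXACT RE-LOCATIONS (the residual shrinks; equivalent modulo the grand decided half) -/

/-- **REFINEMENT EDGE (hypothesis-free)**: g15's residual implies g16's — `Vast.VastSpecialRung → GrandSpecialRung` (WEAKER BY
LETTER). [folklore] -/
theorem grandSpecialRung_of_vastSpecialRung (h : Vast.VastSpecialRung) : GrandSpecialRung :=
  Leaf.specialRung_mono vastLeaf_le_grandLeaf (vastSpecialRung_iff.mp h)

/-- The grand decided half contains g15's: `GrandGenericRung → Vast.VastGenericRung`. [folklore] -/
theorem vastGenericRung_of_grandGenericRung (h : GrandGenericRung) : Vast.VastGenericRung :=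
  vastGenericRung_iff.mpr (Leaf.genericRung_anti vastLeaf_le_grandLeaf h)

end Kernels

end Grand

end Summit.ResolutionOfSingularities.ResolutionOfSingularities.Theorems.PurityCut
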